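import Summits.Parity.BatemanHorn.Theorems.AlmostPrimeZerosDiscMajorantLogCappedEulerDataSharp
import Summits.Parity.BatemanHorn.Theorems.AlmostPrimeZerosDiscMajorantLogRieszDiffNegligibleWide
import Summits.Parity.BatemanHorn.Theorems.AlmostPrimeZerosDiscMajorantLogRieszDiffEngineWide
import Summits.Parity.BatemanHorn.Theorems.AlmostPrimeZerosDiscMajorantLogShortIntervalWide
import Summits.Parity.BatemanHorn.Theorems.AlmostPrimeZerosDiscMajorantLogGrowingDiscXOfParts
import HarnessLib

/-!
# Crux `DiscMajorantLog` (stmt-Parity-17114), line `Sketch`: the cell `k = 1`, `f = X` on the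
GROWING disc — composition of wave 3

The crux `Summit.Parity.BatemanHorn.Theses.AlmostPrimeZeros.DiscMajorantLog` asks, for every
Bateman–Horn system, `‖S_x(z)‖ ≤ A·x·(log x)^{k(Re z − 1)}·exp(C‖z−1‖ log(‖z−1‖+2))` on the growing
disc `‖z − 1‖ ≤ 3 log log x`.  Its docstring records as KNOWN the cell `k = 1`, `f` linear
("Selberg–Delange with `R ≍ log log x`, constants `e^{O(R log R)}`"), which the grounder could not
locate verbatim in print and which was not in the tree (the sibling engine of `LinearCappedRepulsion`
reaches radius `log log x / C` with budget `e^{A(1+‖z−1‖)^{3/2}}`).  This file closes that gap for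
`f = (X)`: `stub_growingDiscX` is the cell at the crux's OWN constants — radius `3 log log x`, harmonic
exponent `(log x)^{Re z − 1}`, Γ-budget `e^{C r log(r+2)}` — composed BY NAME from the five landed
wave-3 stubs of the line:

* `stub_cappedEulerDataSharp` (E1, p142694): the capped Euler product `z^{s(n)}` as engine data on
  `σ > 1 − 1/(4(R+1))` with budget `e^{b(1+R)log(R+2)}`;
* `stub_rieszDiffNegligibleWide` (E2a, p142232) and `stub_rieszDiffEngineWideOfNegligible`
  (E2b, p142388): the one-sided Selberg–Delange bound for a difference of Riesz means, `R ≤ 4 log log x`,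
  keyhole constant kept at `e^{O(R log R)}`;
* `stub_shortIntervalWide` (E3, p142210): de-smoothing over `h = x e^{−(log log x)³}`, `R ≤ 4 log log x`;
* `stub_growingDiscXOfParts` (E4, p142266): the assembly;

together with the landed Rankin majorant `JensenStieltjesMajorant.stub_rankinMajorant` (p-landed in the
sibling crux).  So both composition stubs of the line (`stub_rightHalfDiscMajorantLog`,
`stub_leftHalfDiscMajorantLog`) hold in the cell `k = 1`, `f = X` — on the whole disc, both half-planes
at once; what remains open in them is every system with `k ≥ 2` or `deg ≥ 2` (Halász along `f` on the
right, tilted Chowla along `f` on the left), and `f = aX + b` with `a ≥ 2` (the Dirichlet-character twin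
of the engine).

References: H. L. Montgomery, R. C. Vaughan, *Multiplicative Number Theory I*, CUP 2007, §7.4
(Theorems 7.17–7.18 and their proof, pp. 177–182); G. Tenenbaum, *Introduction to analytic and
probabilistic number theory*, 3rd ed., II.5 (Theorem II.5.2); A. Selberg, Note on a paper by
L. G. Sathe, J. Indian Math. Soc. 18 (1954).
-/

noncomputable section

namespace Summit.Parity.BatemanHorn.Cruxes.DiscMajorantLog.Sketch

/-- **The `k = 1`, `f = X` cell of `DiscMajorantLog` on the growing disc (registered stub
`stub_growingDiscX`).**  There are `A, C, x₀` such that for all `x ≥ x₀` and all `z` with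
`‖z − 1‖ ≤ 3 log log x`:
`‖Σ_{0≤n≤x} z^{s(n)}‖ ≤ A·x·(log x)^{Re z − 1}·exp(C‖z−1‖ log(‖z−1‖+2))`, `s(n) = Σ_{p^v ∥ n} min(v,2)`
— Selberg–Delange with `R = 1 + ‖z − 1‖ ≍ log log x` and every constant traced (`e^{O(R log R)}`).
Composition by name of E1, E2b∘E2a, E3, the Rankin majorant, through E4.
[cite: MontgomeryVaughan2007, §7.4 Theorems 7.17–7.18] -/
theorem stub_growingDiscX :
    ∃ A C : ℝ, ∃ x₀ : ℕ, ∀ x : ℕ, x₀ ≤ x → ∀ z : ℂ, ‖z - 1‖ ≤ 3 * Real.log (Real.log (x : ℝ)) →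
      ‖(∑ n ∈ Finset.range (x + 1), (z : ℂ) ^ (∑ i, ((((![Polynomial.X] : Fin 1 → Polynomial ℤ) i).eval
          (n : ℤ)).toNat.factorization.sum fun _ v => min v 2)))‖ ≤
        A * (x : ℝ) * (Real.log (x : ℝ)) ^ (((1 : ℕ) : ℝ) * ((z : ℂ).re - 1)) *
          Real.exp (C * ‖(z : ℂ) - 1‖ * Real.log (‖(z : ℂ) - 1‖ + 2)) :=
  stub_growingDiscXOfParts stub_cappedEulerDataSharp
    (stub_rieszDiffEngineWideOfNegligible stub_rieszDiffNegligibleWide) stub_shortIntervalWide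
    Summit.Parity.BatemanHorn.Cruxes.LinearCappedRepulsion.JensenStieltjesMajorant.stub_rankinMajorant

/-- Named form of `stub_growingDiscX`: the `k = 1`, `f = X` cell of the crux `DiscMajorantLog` at the
crux's own constants (growing disc `‖z − 1‖ ≤ 3 log log x`, Γ-budget).
[cite: MontgomeryVaughan2007, §7.4 Theorems 7.17–7.18] -/
theorem discMajorantLog_growingDisc_X :
    ∃ A C : ℝ, ∃ x₀ : ℕ, ∀ x : ℕ, x₀ ≤ x → ∀ z : ℂ, ‖z - 1‖ ≤ 3 * Real.log (Real.log (x : ℝ)) →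
      ‖(∑ n ∈ Finset.range (x + 1), (z : ℂ) ^ (∑ i, ((((![Polynomial.X] : Fin 1 → Polynomial ℤ) i).eval
          (n : ℤ)).toNat.factorization.sum fun _ v => min v 2)))‖ ≤
        A * (x : ℝ) * (Real.log (x : ℝ)) ^ (((1 : ℕ) : ℝ) * ((z : ℂ).re - 1)) *
          Real.exp (C * ‖(z : ℂ) - 1‖ * Real.log (‖(z : ℂ) - 1‖ + 2)) :=
  stub_growingDiscX

/-- The `k = 1`, `f = (X)` row of the line's composition stub `stub_rightHalfDiscMajorantLog`
(right half-disc `0 ≤ Re z`) — a theorem (the half-plane restriction is simply dropped from the cell).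
[cite: MontgomeryVaughan2007, §7.4 Theorems 7.17–7.18] -/
theorem rightHalfDiscMajorantLog_X :
    ∃ A C : ℝ, ∃ x₀ : ℕ, ∀ x : ℕ, x₀ ≤ x → ∀ z : ℂ, ‖z - 1‖ ≤ 3 * Real.log (Real.log (x : ℝ)) →
      0 ≤ z.re →
      ‖(∑ n ∈ Finset.range (x + 1), (z : ℂ) ^ (∑ i, ((((![Polynomial.X] : Fin 1 → Polynomial ℤ) i).eval
          (n : ℤ)).toNat.factorization.sum fun _ v => min v 2)))‖ ≤
        A * (x : ℝ) * (Real.log (x : ℝ)) ^ (((1 : ℕ) : ℝ) * ((z : ℂ).re - 1)) *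
          Real.exp (C * ‖(z : ℂ) - 1‖ * Real.log (‖(z : ℂ) - 1‖ + 2)) := by
  obtain ⟨A, C, x₀, h⟩ := stub_growingDiscX
  exact ⟨A, C, x₀, fun x hx z hz _ => h x hx z hz⟩

/-- The `k = 1`, `f = (X)` row of the line's composition stub `stub_leftHalfDiscMajorantLog`
(left half-disc `Re z < 0`, the parity half) — a theorem for this system: at `z = −1` it contains the
Liouville-type saving `|Σ_{n≤x} (−1)^{s(n)}| ≤ A' x (log x)^{−2}`. [cite: MontgomeryVaughan2007, §7.4 Theorems 7.17–7.18] -/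
theorem leftHalfDiscMajorantLog_X :
    ∃ A C : ℝ, ∃ x₀ : ℕ, ∀ x : ℕ, x₀ ≤ x → ∀ z : ℂ, ‖z - 1‖ ≤ 3 * Real.log (Real.log (x : ℝ)) →
      z.re < 0 →
      ‖(∑ n ∈ Finset.range (x + 1), (z : ℂ) ^ (∑ i, ((((![Polynomial.X] : Fin 1 → Polynomial ℤ) i).eval
          (n : ℤ)).toNat.factorization.sum fun _ v => min v 2)))‖ ≤
        A * (x : ℝ) * (Real.log (x : ℝ)) ^ (((1 : ℕ) : ℝ) * ((z : ℂ).re - 1)) *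
          Real.exp (C * ‖(z : ℂ) - 1‖ * Real.log (‖(z : ℂ) - 1‖ + 2)) := by
  obtain ⟨A, C, x₀, h⟩ := stub_growingDiscX
  exact ⟨A, C, x₀, fun x hx z hz _ => h x hx z hz⟩

/-- **Plain form** (the statistic written as `s(n) = Σ_{p^v ∥ n} min(v,2)` of `n` itself, for
consumers outside this crux): there are `A, C, x₀` with
`‖Σ_{0≤n≤x} z^{s(n)}‖ ≤ A·x·(log x)^{Re z − 1}·exp(C‖z−1‖ log(‖z−1‖+2))` for all natural `x ≥ x₀` and all
`‖z − 1‖ ≤ 3 log log x` — the one-sided Selberg–Delange majorant with growing radius and Γ-budget.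
[cite: MontgomeryVaughan2007, §7.4 Theorems 7.17–7.18] -/
theorem norm_sum_capped_le_growingDisc :
    ∃ A C : ℝ, ∃ x₀ : ℕ, ∀ x : ℕ, x₀ ≤ x → ∀ z : ℂ, ‖z - 1‖ ≤ 3 * Real.log (Real.log (x : ℝ)) →
      ‖∑ n ∈ Finset.range (x + 1), z ^ (n.factorization.sum fun _ v => min v 2)‖ ≤
        A * (x : ℝ) * (Real.log (x : ℝ)) ^ (z.re - 1) *
          Real.exp (C * ‖z - 1‖ * Real.log (‖z - 1‖ + 2)) := by
  obtain ⟨A, C, x₀, h⟩ := stub_growingDiscX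
  refine ⟨A, C, x₀, fun x hx z hz => ?_⟩
  have h1 := h x hx z hz
  simp_rw [FixedDiscX.exponent_X] at h1
  simpa only [Nat.cast_one, one_mul] using h1

end Summit.Parity.BatemanHorn.Cruxes.DiscMajorantLog.Sketch

end
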